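import Mathlib
import HarnessLib
import Summits.ResolutionOfSingularities.ResolutionOfSingularities.Theorems.WildQuotientsWildQuotientResolutionToricExitTransferThree
import Summits.ResolutionOfSingularities.ResolutionOfSingularities.Theorems.WildQuotientsWildQuotientResolutionToricExitCover
import Summits.ResolutionOfSingularities.ResolutionOfSingularities.Theorems.WildQuotientsWildQuotientResolutionToricExitChartStable
import Summits.ResolutionOfSingularities.ResolutionOfSingularities.Theorems.WildQuotientsWildQuotientResolutionToricExitJordanThreeBrickNonempty
import Summits.ResolutionOfSingularities.ResolutionOfSingularities.Theorems.WildQuotientsWildQuotientResolutionJordanFourI6StableJ4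
import Summits.ResolutionOfSingularities.ResolutionOfSingularities.Theorems.WildQuotientsWildQuotientResolutionJordanFourOrder
import Summits.ResolutionOfSingularities.ResolutionOfSingularities.Theorems.WildQuotientsWildQuotientResolutionAffineQuotientData
import Summits.ResolutionOfSingularities.ResolutionOfSingularities.Theorems.WildQuotientsWildQuotientResolutionAffineQuotientEtale
import Summits.ResolutionOfSingularities.ResolutionOfSingularities.Theorems.WildQuotientsWildQuotientResolutionLinearSmallBlocksAlgebra
import Summits.ResolutionOfSingularities.ResolutionOfSingularities.Theorems.WildQuotientsWildQuotientResolutionFixedPointsRegular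
import Summits.ResolutionOfSingularities.ResolutionOfSingularities.Theorems.WildQuotientsGaloisQuotientStableCover
import Literature.AlgebraicGeometry.Resolution.BlowupPrincipalCharts
import Literature.AlgebraicGeometry.Resolution.BlowupsEquivariant
import Summits.ResolutionOfSingularities.ResolutionOfSingularities.Theorems.WildQuotientsWildQuotientResolutionFixedPointsGraded

/-!
# V4U-F: the J₄ toric exit with three pieces, assembled modulo its bricks
(crux stmt-ResolutionOfSingularities-15640 `WildQuotients.WildQuotientResolution`, line `Sketch`;
chain w45c programme V4U, `L/w45c/CHAIN.md` v6 §4 lead-1 row «V4U-F», design of record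
`L/w45c/V4U-DESIGN.md` §1–§5; [OURS · L1 W4.5c] — NOT a statement of any manuscript; replaces the
role of no printed item.)

`JordanFour.jordanFour_hasResolution_of_bricks`: for the `J₄` datum (`σ x_a = x_a`,
`σ x_b = x_b + x_a`, `σ x_c = x_c + x_b`, `σ x_d = x_d + x_c`, passengers fixed) over a field of
characteristic `p ≥ 5`, `Spec k[x]^⟨σ⟩` has a resolution of singularities PROVIDED the bricks of
the three-piece toric exit hold for `V = Bl_{I₆} 𝔸ⁿ` (`I₆ = (x_a², x_ax_b², x_ax_bx_c, x_ax_c³,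
x_b³, x_b²x_c², x_bx_c⁴, x_c⁶)`, p490963) with the lifted action (`IsBlowup.liftAction`, hρ =
`JordanFour.idealSheaf_I6_comap`), its principal charts `V[g_j] = blowupChart π Ĩ₆ ⊤ g_j`
(Literature `BlowupPrincipalCharts`), the vertex curves
`C₀ = π⁻¹V(x_a,x_b,x_c) ∖ ⋃_{j ≠ 0} V[g_j]`, `C₁ = π⁻¹V(x_a,x_b,x_c) ∖ ⋃_{j ≠ 4} V[g_j]`
(V4U-DESIGN §1), and an open `W ⊆ V` (of record: the twisted root chart
`W_T = D₊(T′H′³t³)`, V4U-DESIGN §3; here ABSTRACT):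

* `HWst`/`HWaff`/`Hcov`/`HC₀W`/`HC₁W` — `W` is stable under the lifted action, affine,
  `V[x_a²] ∪ W ∪ V[x_c⁶] = V`, `C₀ ∩ W = ∅`, `C₁ ⊆ W` (stub-2 T2 (c)(d));
* `HregC`/`HdivC` — the points of `V[x_c⁶]` have regular local rings, and at every fixed point of
  `V[x_c⁶]` the stalk augmentation ideal of the lifted action is principal (stub-2 p489593 +
  stub-4 p493991 + the chart dictionary; stub-5's offer 2026-08-27T05:07:14Z);
* `HP₀` — THE μ₃ CONE BRICK: some blow-up of the quotient piece `V[x_a²]/G` along the ideal sheaf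
  of the image of `C₀` is regular (B0 + C4⅓ + E, V4U-DESIGN §2);
* `HP₁` — THE μ₂ CONE BRICK: the same for `W/G` and `C₁` (T1 + T2 + C4½ + E, V4U-DESIGN §3).

Everything else is discharged here: the crux data of `𝔸ⁿ → 𝔸ⁿ/⟨σ⟩` (`AffineQuotient.*`, order `p`
by `JordanFour.card_zpowers_prime`, generic étaleness over `D(x_a)`), the model
(`JordanFour.I6_blowup_integral_proper_birational`), the `G`-stability of `V[x_a²]`
(`ToricExit.preimage_blowupChart_eq_self_of_action`, since `σ x_a² = x_a²`), the stable affine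
piece `O₂ = ⋂ g·V[x_c⁶]` (`ToricExit.exists_stable_affine_cover_pair`) and its non-emptiness
(`BlowupExit.nonempty_iInf_preimage_of_irreducibleSpace`, p498242), the cover
`⋃_j V[g_j] = V` (`IsBlowup.iSup_blowupChart`), the topology of `C₀`, `C₁`, and the three-piece exit
`ToricExit.toricExitTransfer₃`.
-/

-- single-problem summit: the doubled namespace component `ResolutionOfSingularities` is forced
set_option linter.dupNamespace false

noncomputable section

open CategoryTheory AlgebraicGeometry TopologicalSpace MvPolynomial
open Literature.AlgebraicGeometry.Resolution Literature.AlgebraicGeometry.RelativeSpec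

namespace Summit.ResolutionOfSingularities.ResolutionOfSingularities.Theorems.WildQuotientResolution.JordanFour

-- the glued-quotient / blow-up bookkeeping is individually cheap but numerous
set_option maxHeartbeats 1600000 in
/-- **The J₄ toric exit modulo its bricks** (see the module docstring for the bricks `HWst`,
`HWaff`, `Hcov`, `HC₀W`, `HC₁W`, `HregC`, `HdivC`, `HP₀`, `HP₁`). [OURS · L1 W4.5c]
[folklore; assembly of landed decls] -/
theorem jordanFour_hasResolution_of_bricks (p : ℕ) (hp : p.Prime) (hp5 : 5 ≤ p)
    (k : Type) [Field k] [CharP k p] (n : ℕ)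
    (σ : MvPolynomial (Fin n) k ≃ₐ[k] MvPolynomial (Fin n) k) [Finite ↥(Subgroup.zpowers σ)]
    (a b c d : Fin n) (hab : a ≠ b) (hac : a ≠ c) (had : a ≠ d) (_hbc : b ≠ c) (_hbd : b ≠ d)
    (_hcd : c ≠ d)
    (hb : σ (X b) = X b + X a) (hc : σ (X c) = X c + X b) (hd : σ (X d) = X d + X c)
    (hσ : ∀ i, i ≠ b → i ≠ c → i ≠ d → σ (X i) = X i)
    (W : (affineBlowup (Ideal.span (Set.range (![X a ^ 2, X a * X b ^ 2, X a * X b * X c, X a * X c ^ 3, X b ^ 3, X b ^ 2 * X c ^ 2, X b * X c ^ 4, X c ^ 6] : Fin 8 → MvPolynomial (Fin n) k)))).Opens)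
    (HWst : ∀ (ρ : ↥(Subgroup.zpowers σ) →* Aut (Spec (CommRingCat.of (MvPolynomial (Fin n) k))))
      (hρ : ∀ g : ↥(Subgroup.zpowers σ), (ρ g).hom = Spec.map (CommRingCat.ofHom
        ((MulSemiringAction.toRingEquiv (↥(Subgroup.zpowers σ)) (MvPolynomial (Fin n) k) g⁻¹ :
          MvPolynomial (Fin n) k ≃+* MvPolynomial (Fin n) k) :
            MvPolynomial (Fin n) k →+* MvPolynomial (Fin n) k)))
      (g : ↥(Subgroup.zpowers σ)),
      (((affineBlowup.isBlowup (Ideal.span (Set.range (![X a ^ 2, X a * X b ^ 2, X a * X b * X c, X a * X c ^ 3, X b ^ 3, X b ^ 2 * X c ^ 2, X b * X c ^ 4, X c ^ 6] : Fin 8 → MvPolynomial (Fin n) k)))).liftAction ρ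
        (idealSheaf_I6_comap k n σ a b c (hσ a hab hac had) hb hc ρ hρ)) g).hom ⁻¹ᵁ W = W)
    (HWaff : IsAffineOpen W)
    (Hcov : blowupChart
        (affineBlowup.π (Ideal.span (Set.range (![X a ^ 2, X a * X b ^ 2, X a * X b * X c, X a * X c ^ 3, X b ^ 3, X b ^ 2 * X c ^ 2, X b * X c ^ 4, X c ^ 6] : Fin 8 → MvPolynomial (Fin n) k))))
        (affineBlowup.idealSheaf (Ideal.span (Set.range (![X a ^ 2, X a * X b ^ 2, X a * X b * X c, X a * X c ^ 3, X b ^ 3, X b ^ 2 * X c ^ 2, X b * X c ^ 4, X c ^ 6] : Fin 8 → MvPolynomial (Fin n) k))))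
        ⟨⊤, isAffineOpen_top _⟩
        ((Scheme.ΓSpecIso (CommRingCat.of (MvPolynomial (Fin n) k))).inv.hom (X a ^ 2)) ⊔ W ⊔
      blowupChart
        (affineBlowup.π (Ideal.span (Set.range (![X a ^ 2, X a * X b ^ 2, X a * X b * X c, X a * X c ^ 3, X b ^ 3, X b ^ 2 * X c ^ 2, X b * X c ^ 4, X c ^ 6] : Fin 8 → MvPolynomial (Fin n) k))))
        (affineBlowup.idealSheaf (Ideal.span (Set.range (![X a ^ 2, X a * X b ^ 2, X a * X b * X c, X a * X c ^ 3, X b ^ 3, X b ^ 2 * X c ^ 2, X b * X c ^ 4, X c ^ 6] : Fin 8 → MvPolynomial (Fin n) k))))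
        ⟨⊤, isAffineOpen_top _⟩
        ((Scheme.ΓSpecIso (CommRingCat.of (MvPolynomial (Fin n) k))).inv.hom (X c ^ 6)) = ⊤)
    (HC₀W : Disjoint
      ({v | (affineBlowup.π (Ideal.span (Set.range (![X a ^ 2, X a * X b ^ 2, X a * X b * X c, X a * X c ^ 3, X b ^ 3, X b ^ 2 * X c ^ 2, X b * X c ^ 4, X c ^ 6] : Fin 8 → MvPolynomial (Fin n) k)))).base v ∈
          PrimeSpectrum.zeroLocus ({X a, X b, X c} : Set (MvPolynomial (Fin n) k))} \
        ((⨆ j : {j : Fin 8 // j ≠ 0}, blowupChart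
          (affineBlowup.π (Ideal.span (Set.range (![X a ^ 2, X a * X b ^ 2, X a * X b * X c, X a * X c ^ 3, X b ^ 3, X b ^ 2 * X c ^ 2, X b * X c ^ 4, X c ^ 6] : Fin 8 → MvPolynomial (Fin n) k))))
          (affineBlowup.idealSheaf (Ideal.span (Set.range (![X a ^ 2, X a * X b ^ 2, X a * X b * X c, X a * X c ^ 3, X b ^ 3, X b ^ 2 * X c ^ 2, X b * X c ^ 4, X c ^ 6] : Fin 8 → MvPolynomial (Fin n) k))))
          ⟨⊤, isAffineOpen_top _⟩
          ((Scheme.ΓSpecIso (CommRingCat.of (MvPolynomial (Fin n) k))).inv.hom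
            ((![X a ^ 2, X a * X b ^ 2, X a * X b * X c, X a * X c ^ 3, X b ^ 3, X b ^ 2 * X c ^ 2, X b * X c ^ 4, X c ^ 6] : Fin 8 → MvPolynomial (Fin n) k) j.1)) :
          (affineBlowup (Ideal.span (Set.range (![X a ^ 2, X a * X b ^ 2, X a * X b * X c, X a * X c ^ 3, X b ^ 3, X b ^ 2 * X c ^ 2, X b * X c ^ 4, X c ^ 6] : Fin 8 → MvPolynomial (Fin n) k)))).Opens) : Set _))
      (W : Set _))
    (HC₁W : {v | (affineBlowup.π (Ideal.span (Set.range (![X a ^ 2, X a * X b ^ 2, X a * X b * X c, X a * X c ^ 3, X b ^ 3, X b ^ 2 * X c ^ 2, X b * X c ^ 4, X c ^ 6] : Fin 8 → MvPolynomial (Fin n) k)))).base v ∈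
          PrimeSpectrum.zeroLocus ({X a, X b, X c} : Set (MvPolynomial (Fin n) k))} \
        ((⨆ j : {j : Fin 8 // j ≠ 4}, blowupChart
          (affineBlowup.π (Ideal.span (Set.range (![X a ^ 2, X a * X b ^ 2, X a * X b * X c, X a * X c ^ 3, X b ^ 3, X b ^ 2 * X c ^ 2, X b * X c ^ 4, X c ^ 6] : Fin 8 → MvPolynomial (Fin n) k))))
          (affineBlowup.idealSheaf (Ideal.span (Set.range (![X a ^ 2, X a * X b ^ 2, X a * X b * X c, X a * X c ^ 3, X b ^ 3, X b ^ 2 * X c ^ 2, X b * X c ^ 4, X c ^ 6] : Fin 8 → MvPolynomial (Fin n) k))))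
          ⟨⊤, isAffineOpen_top _⟩
          ((Scheme.ΓSpecIso (CommRingCat.of (MvPolynomial (Fin n) k))).inv.hom
            ((![X a ^ 2, X a * X b ^ 2, X a * X b * X c, X a * X c ^ 3, X b ^ 3, X b ^ 2 * X c ^ 2, X b * X c ^ 4, X c ^ 6] : Fin 8 → MvPolynomial (Fin n) k) j.1)) :
          (affineBlowup (Ideal.span (Set.range (![X a ^ 2, X a * X b ^ 2, X a * X b * X c, X a * X c ^ 3, X b ^ 3, X b ^ 2 * X c ^ 2, X b * X c ^ 4, X c ^ 6] : Fin 8 → MvPolynomial (Fin n) k)))).Opens) : Set _) ⊆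
      (W : Set _))
    (HregC : ∀ v ∈ blowupChart
        (affineBlowup.π (Ideal.span (Set.range (![X a ^ 2, X a * X b ^ 2, X a * X b * X c, X a * X c ^ 3, X b ^ 3, X b ^ 2 * X c ^ 2, X b * X c ^ 4, X c ^ 6] : Fin 8 → MvPolynomial (Fin n) k))))
        (affineBlowup.idealSheaf (Ideal.span (Set.range (![X a ^ 2, X a * X b ^ 2, X a * X b * X c, X a * X c ^ 3, X b ^ 3, X b ^ 2 * X c ^ 2, X b * X c ^ 4, X c ^ 6] : Fin 8 → MvPolynomial (Fin n) k))))
        ⟨⊤, isAffineOpen_top _⟩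
        ((Scheme.ΓSpecIso (CommRingCat.of (MvPolynomial (Fin n) k))).inv.hom (X c ^ 6)),
      IsRegularLocalRing ((affineBlowup (Ideal.span (Set.range (![X a ^ 2, X a * X b ^ 2, X a * X b * X c, X a * X c ^ 3, X b ^ 3, X b ^ 2 * X c ^ 2, X b * X c ^ 4, X c ^ 6] : Fin 8 → MvPolynomial (Fin n) k)))).presheaf.stalk v))
    (HdivC : ∀ (ρ : ↥(Subgroup.zpowers σ) →* Aut (Spec (CommRingCat.of (MvPolynomial (Fin n) k))))
      (hρ : ∀ g : ↥(Subgroup.zpowers σ), (ρ g).hom = Spec.map (CommRingCat.ofHom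
        ((MulSemiringAction.toRingEquiv (↥(Subgroup.zpowers σ)) (MvPolynomial (Fin n) k) g⁻¹ :
          MvPolynomial (Fin n) k ≃+* MvPolynomial (Fin n) k) :
            MvPolynomial (Fin n) k →+* MvPolynomial (Fin n) k)))
      (g : ↥(Subgroup.zpowers σ))
      (v : affineBlowup (Ideal.span (Set.range (![X a ^ 2, X a * X b ^ 2, X a * X b * X c, X a * X c ^ 3, X b ^ 3, X b ^ 2 * X c ^ 2, X b * X c ^ 4, X c ^ 6] : Fin 8 → MvPolynomial (Fin n) k))))
      (hv : (((affineBlowup.isBlowup (Ideal.span (Set.range (![X a ^ 2, X a * X b ^ 2, X a * X b * X c, X a * X c ^ 3, X b ^ 3, X b ^ 2 * X c ^ 2, X b * X c ^ 4, X c ^ 6] : Fin 8 → MvPolynomial (Fin n) k)))).liftAction ρ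
          (idealSheaf_I6_comap k n σ a b c (hσ a hab hac had) hb hc ρ hρ)) g).hom.base v = v),
      v ∈ blowupChart
        (affineBlowup.π (Ideal.span (Set.range (![X a ^ 2, X a * X b ^ 2, X a * X b * X c, X a * X c ^ 3, X b ^ 3, X b ^ 2 * X c ^ 2, X b * X c ^ 4, X c ^ 6] : Fin 8 → MvPolynomial (Fin n) k))))
        (affineBlowup.idealSheaf (Ideal.span (Set.range (![X a ^ 2, X a * X b ^ 2, X a * X b * X c, X a * X c ^ 3, X b ^ 3, X b ^ 2 * X c ^ 2, X b * X c ^ 4, X c ^ 6] : Fin 8 → MvPolynomial (Fin n) k))))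
        ⟨⊤, isAffineOpen_top _⟩
        ((Scheme.ΓSpecIso (CommRingCat.of (MvPolynomial (Fin n) k))).inv.hom (X c ^ 6)) →
      (Ideal.span (Set.range fun s =>
        ((affineBlowup (Ideal.span (Set.range (![X a ^ 2, X a * X b ^ 2, X a * X b * X c, X a * X c ^ 3, X b ^ 3, X b ^ 2 * X c ^ 2, X b * X c ^ 4, X c ^ 6] : Fin 8 → MvPolynomial (Fin n) k)))).presheaf.stalkSpecializes
            (specializes_of_eq hv) ≫
          (((affineBlowup.isBlowup (Ideal.span (Set.range (![X a ^ 2, X a * X b ^ 2, X a * X b * X c, X a * X c ^ 3, X b ^ 3, X b ^ 2 * X c ^ 2, X b * X c ^ 4, X c ^ 6] : Fin 8 → MvPolynomial (Fin n) k)))).liftAction ρ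
            (idealSheaf_I6_comap k n σ a b c (hσ a hab hac had) hb hc ρ hρ)) g).hom.stalkMap v).hom
              s - s)).IsPrincipal)
    (HP₀ : ∀ (ρ : ↥(Subgroup.zpowers σ) →* Aut (Spec (CommRingCat.of (MvPolynomial (Fin n) k))))
      (hρ : ∀ g : ↥(Subgroup.zpowers σ), (ρ g).hom = Spec.map (CommRingCat.ofHom
        ((MulSemiringAction.toRingEquiv (↥(Subgroup.zpowers σ)) (MvPolynomial (Fin n) k) g⁻¹ :
          MvPolynomial (Fin n) k ≃+* MvPolynomial (Fin n) k) :
            MvPolynomial (Fin n) k →+* MvPolynomial (Fin n) k)))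
      (ρB : ActionOver
        (affineBlowup.π (Ideal.span (Set.range (![X a ^ 2, X a * X b ^ 2, X a * X b * X c, X a * X c ^ 3, X b ^ 3, X b ^ 2 * X c ^ 2, X b * X c ^ 4, X c ^ 6] : Fin 8 → MvPolynomial (Fin n) k))) ≫
          Spec.map (CommRingCat.ofHom (algebraMap
            (FixedPoints.subalgebra k (MvPolynomial (Fin n) k) (Subgroup.zpowers σ))
            (MvPolynomial (Fin n) k))))
        ↥(Subgroup.zpowers σ))
      (_ : ρB.aut = (affineBlowup.isBlowup (Ideal.span (Set.range (![X a ^ 2, X a * X b ^ 2, X a * X b * X c, X a * X c ^ 3, X b ^ 3, X b ^ 2 * X c ^ 2, X b * X c ^ 4, X c ^ 6] : Fin 8 → MvPolynomial (Fin n) k)))).liftAction ρ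
          (idealSheaf_I6_comap k n σ a b c (hσ a hab hac had) hb hc ρ hρ))
      (O₀ : ρB.StableAffineOpens)
      (_ : O₀.1 = blowupChart
        (affineBlowup.π (Ideal.span (Set.range (![X a ^ 2, X a * X b ^ 2, X a * X b * X c, X a * X c ^ 3, X b ^ 3, X b ^ 2 * X c ^ 2, X b * X c ^ 4, X c ^ 6] : Fin 8 → MvPolynomial (Fin n) k))))
        (affineBlowup.idealSheaf (Ideal.span (Set.range (![X a ^ 2, X a * X b ^ 2, X a * X b * X c, X a * X c ^ 3, X b ^ 3, X b ^ 2 * X c ^ 2, X b * X c ^ 4, X c ^ 6] : Fin 8 → MvPolynomial (Fin n) k))))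
        ⟨⊤, isAffineOpen_top _⟩
        ((Scheme.ΓSpecIso (CommRingCat.of (MvPolynomial (Fin n) k))).inv.hom (X a ^ 2)))
      (Z₀ : Closeds (ρB.pieceQuot O₀)),
      (Z₀ : Set (ρB.pieceQuot O₀)) = (ρB.pieceMk O₀).base ''
        (O₀.1.ι.base ⁻¹'
          ({v | (affineBlowup.π (Ideal.span (Set.range (![X a ^ 2, X a * X b ^ 2, X a * X b * X c, X a * X c ^ 3, X b ^ 3, X b ^ 2 * X c ^ 2, X b * X c ^ 4, X c ^ 6] : Fin 8 → MvPolynomial (Fin n) k)))).base v ∈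
              PrimeSpectrum.zeroLocus ({X a, X b, X c} : Set (MvPolynomial (Fin n) k))} \
            ((⨆ j : {j : Fin 8 // j ≠ 0}, blowupChart
              (affineBlowup.π (Ideal.span (Set.range (![X a ^ 2, X a * X b ^ 2, X a * X b * X c, X a * X c ^ 3, X b ^ 3, X b ^ 2 * X c ^ 2, X b * X c ^ 4, X c ^ 6] : Fin 8 → MvPolynomial (Fin n) k))))
              (affineBlowup.idealSheaf (Ideal.span (Set.range (![X a ^ 2, X a * X b ^ 2, X a * X b * X c, X a * X c ^ 3, X b ^ 3, X b ^ 2 * X c ^ 2, X b * X c ^ 4, X c ^ 6] : Fin 8 → MvPolynomial (Fin n) k))))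
              ⟨⊤, isAffineOpen_top _⟩
              ((Scheme.ΓSpecIso (CommRingCat.of (MvPolynomial (Fin n) k))).inv.hom
                ((![X a ^ 2, X a * X b ^ 2, X a * X b * X c, X a * X c ^ 3, X b ^ 3, X b ^ 2 * X c ^ 2, X b * X c ^ 4, X c ^ 6] : Fin 8 → MvPolynomial (Fin n) k)
                    j.1)) :
              (affineBlowup (Ideal.span (Set.range (![X a ^ 2, X a * X b ^ 2, X a * X b * X c, X a * X c ^ 3, X b ^ 3, X b ^ 2 * X c ^ 2, X b * X c ^ 4, X c ^ 6] : Fin 8 → MvPolynomial (Fin n) k)))).Opens) : Set _))) →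
      ∃ (B : Scheme.{0}) (pB : B ⟶ ρB.pieceQuot O₀),
        IsBlowup pB (Scheme.IdealSheafData.vanishingIdeal Z₀) ∧ Scheme.IsRegular B)
    (HP₁ : ∀ (ρ : ↥(Subgroup.zpowers σ) →* Aut (Spec (CommRingCat.of (MvPolynomial (Fin n) k))))
      (hρ : ∀ g : ↥(Subgroup.zpowers σ), (ρ g).hom = Spec.map (CommRingCat.ofHom
        ((MulSemiringAction.toRingEquiv (↥(Subgroup.zpowers σ)) (MvPolynomial (Fin n) k) g⁻¹ :
          MvPolynomial (Fin n) k ≃+* MvPolynomial (Fin n) k) :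
            MvPolynomial (Fin n) k →+* MvPolynomial (Fin n) k)))
      (ρB : ActionOver
        (affineBlowup.π (Ideal.span (Set.range (![X a ^ 2, X a * X b ^ 2, X a * X b * X c, X a * X c ^ 3, X b ^ 3, X b ^ 2 * X c ^ 2, X b * X c ^ 4, X c ^ 6] : Fin 8 → MvPolynomial (Fin n) k))) ≫
          Spec.map (CommRingCat.ofHom (algebraMap
            (FixedPoints.subalgebra k (MvPolynomial (Fin n) k) (Subgroup.zpowers σ))
            (MvPolynomial (Fin n) k))))
        ↥(Subgroup.zpowers σ))
      (_ : ρB.aut = (affineBlowup.isBlowup (Ideal.span (Set.range (![X a ^ 2, X a * X b ^ 2, X a * X b * X c, X a * X c ^ 3, X b ^ 3, X b ^ 2 * X c ^ 2, X b * X c ^ 4, X c ^ 6] : Fin 8 → MvPolynomial (Fin n) k)))).liftAction ρ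
          (idealSheaf_I6_comap k n σ a b c (hσ a hab hac had) hb hc ρ hρ))
      (O₁ : ρB.StableAffineOpens) (_ : O₁.1 = W)
      (Z₁ : Closeds (ρB.pieceQuot O₁)),
      (Z₁ : Set (ρB.pieceQuot O₁)) = (ρB.pieceMk O₁).base ''
        (O₁.1.ι.base ⁻¹'
          ({v | (affineBlowup.π (Ideal.span (Set.range (![X a ^ 2, X a * X b ^ 2, X a * X b * X c, X a * X c ^ 3, X b ^ 3, X b ^ 2 * X c ^ 2, X b * X c ^ 4, X c ^ 6] : Fin 8 → MvPolynomial (Fin n) k)))).base v ∈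
              PrimeSpectrum.zeroLocus ({X a, X b, X c} : Set (MvPolynomial (Fin n) k))} \
            ((⨆ j : {j : Fin 8 // j ≠ 4}, blowupChart
              (affineBlowup.π (Ideal.span (Set.range (![X a ^ 2, X a * X b ^ 2, X a * X b * X c, X a * X c ^ 3, X b ^ 3, X b ^ 2 * X c ^ 2, X b * X c ^ 4, X c ^ 6] : Fin 8 → MvPolynomial (Fin n) k))))
              (affineBlowup.idealSheaf (Ideal.span (Set.range (![X a ^ 2, X a * X b ^ 2, X a * X b * X c, X a * X c ^ 3, X b ^ 3, X b ^ 2 * X c ^ 2, X b * X c ^ 4, X c ^ 6] : Fin 8 → MvPolynomial (Fin n) k))))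
              ⟨⊤, isAffineOpen_top _⟩
              ((Scheme.ΓSpecIso (CommRingCat.of (MvPolynomial (Fin n) k))).inv.hom
                ((![X a ^ 2, X a * X b ^ 2, X a * X b * X c, X a * X c ^ 3, X b ^ 3, X b ^ 2 * X c ^ 2, X b * X c ^ 4, X c ^ 6] : Fin 8 → MvPolynomial (Fin n) k)
                    j.1)) :
              (affineBlowup (Ideal.span (Set.range (![X a ^ 2, X a * X b ^ 2, X a * X b * X c, X a * X c ^ 3, X b ^ 3, X b ^ 2 * X c ^ 2, X b * X c ^ 4, X c ^ 6] : Fin 8 → MvPolynomial (Fin n) k)))).Opens) : Set _))) →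
      ∃ (B : Scheme.{0}) (pB : B ⟶ ρB.pieceQuot O₁),
        IsBlowup pB (Scheme.IdealSheafData.vanishingIdeal Z₁) ∧ Scheme.IsRegular B) :
    Scheme.HasResolution
      (Spec (.of (FixedPoints.subalgebra k (MvPolynomial (Fin n) k) (Subgroup.zpowers σ)))) := by
  classical
  haveI : Fact (Nat.Prime p) := ⟨hp⟩
  have ha : σ (X a) = X a := hσ a hab hac had
  have hσp : σ ^ p = 1 := pow_prime_eq_one k n σ a b c d hab hac had hb hc hd hσ p hp hp5
  have hcard : Nat.card (Subgroup.zpowers σ) = p :=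
    card_zpowers_prime k n σ a b c d hab hac had hb hc hd hσ p hp hp5
  have hn : 0 < n := Fin.pos a
  -- the rings: `S = k[x]`, `G = ⟨σ⟩`, `A = S^G`
  let S : Type := MvPolynomial (Fin n) k
  let G : Type := ↥(Subgroup.zpowers σ)
  let A : Subalgebra k S := FixedPoints.subalgebra k S G
  -- the action on `𝔸ⁿ`
  obtain ⟨ρ, hρ⟩ := AffineQuotient.exists_specAction S G
  -- the quotient data
  let fk : Spec (.of A) ⟶ Spec (.of k) := Spec.map (CommRingCat.ofHom (algebraMap k A))
  let q : Spec (.of S) ⟶ Spec (.of A) := Spec.map (CommRingCat.ofHom (algebraMap A S))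
  haveI : LocallyOfFiniteType fk := AffineQuotient.locallyOfFiniteType_specMap_fixedPoints k
  haveI : IsFinite q := AffineQuotient.isFinite_specMap_fixedPoints k
  have hsurj : Function.Surjective q.base := AffineQuotient.surjective_specMap_fixedPoints k
  have hρq : ∀ g : G, (ρ g).hom ≫ q = q := AffineQuotient.specAction_comp k ρ hρ
  have horb : ∀ x y : Spec (CommRingCat.of S), q.base x = q.base y →
      ∃ g : G, (ρ g).hom.base x = y :=
    fun x y hxy => AffineQuotient.exists_specAction_base_eq k ρ hρ x y hxy
  -- faithfulness of `ρ`
  have hfaith : Function.Injective ρ := by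
    intro g h hgh
    have h1 : (ρ g).hom = (ρ h).hom := by rw [hgh]
    rw [hρ, hρ] at h1
    have h2 := Spec.map_injective h1
    have h3 : ∀ x : S, g⁻¹ • x = h⁻¹ • x := fun x => by
      have := congrArg (fun f : CommRingCat.of S ⟶ CommRingCat.of S => f.hom x) h2
      simpa using this
    have h4 : g⁻¹ = h⁻¹ := Subtype.ext (AlgEquiv.ext fun x => h3 x)
    exact inv_injective h4
  -- generically étale: over `D(x_a)`
  have hXa : (X a : S) ∈ A := (TameTransfer.mem_fixedPoints_zpowers_iff_apply_eq σ (X a)).mpr ha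
  have ht0 : (⟨X a, hXa⟩ : A) ≠ 0 := fun h =>
    MvPolynomial.X_ne_zero a (congrArg Subtype.val h : ((⟨X a, hXa⟩ : A) : S) = ((0 : A) : S))
  have hU : ∃ U : (Spec (.of A)).Opens, Dense (U : Set (Spec (.of A))) ∧ Etale (q ∣_ U) :=
    AffineQuotient.exists_dense_etale_morphismRestrict k (⟨X a, hXa⟩ : A) ht0
      fun g hg => LinearSmallBlocks.X_mem_augIdeal_of_transvection k p hp σ a b ha hb hσp g hg
  -- `dim X₁ = n > 0`
  have hdim : ¬ topologicalKrullDim (Spec (CommRingCat.of A)) ≤ 0 := by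
    rw [AffineQuotient.topologicalKrullDim_spec_fixedPoints k,
      AffineQuotient.topologicalKrullDim_spec_mvPolynomial k n]
    have hn' : (0 : WithBot ℕ∞) < (n : WithBot ℕ∞) := by exact_mod_cast hn
    exact not_le.mpr hn'
  -- the model `V = Bl_{I₆} 𝔸ⁿ` with the lifted action
  let g8 : Fin 8 → S := ![X a ^ 2, X a * X b ^ 2, X a * X b * X c, X a * X c ^ 3, X b ^ 3,
    X b ^ 2 * X c ^ 2, X b * X c ^ 4, X c ^ 6]
  let I₆ : Ideal S := Ideal.span (Set.range g8)
  have hπ : IsBlowup (affineBlowup.π I₆) (affineBlowup.idealSheaf I₆) := affineBlowup.isBlowup I₆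
  obtain ⟨hVint, hVprop, hbir⟩ := I6_blowup_integral_proper_birational k n a b c
  have hJ : ∀ g : G, (affineBlowup.idealSheaf I₆).comap (ρ g).hom = affineBlowup.idealSheaf I₆ :=
    idealSheaf_I6_comap k n σ a b c ha hb hc ρ hρ
  have hequiv : ∀ g : G, (hπ.liftAction ρ hJ g).hom ≫ affineBlowup.π I₆ =
      affineBlowup.π I₆ ≫ (ρ g).hom := fun g => hπ.liftAction_hom_comp ρ hJ g
  haveI : (Spec (CommRingCat.of A)).IsSeparated := inferInstance
  let ρB : ActionOver (affineBlowup.π I₆ ≫ q) G :=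
    ⟨hπ.liftAction ρ hJ, fun g => by rw [← Category.assoc, hequiv g, Category.assoc, hρq g]⟩
  -- the sections `g_j` of `Γ(𝔸ⁿ, ⊤)` and the principal charts
  let ι₀ : S →+* Γ(Spec (CommRingCat.of S), ⊤) := (Scheme.ΓSpecIso (CommRingCat.of S)).inv.hom
  have hIdeal : (affineBlowup.idealSheaf I₆).ideal ⟨⊤, isAffineOpen_top _⟩ = I₆.map ι₀ := by
    change (Scheme.IdealSheafData.ofIdealTop _).ideal ⟨⊤, isAffineOpen_top _⟩ = _
    rw [ideal_ofIdealTop_top]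
  have hgj : ∀ j : Fin 8, ι₀ (g8 j) ∈ (affineBlowup.idealSheaf I₆).ideal ⟨⊤, isAffineOpen_top _⟩ :=
    fun j => by rw [hIdeal]; exact Ideal.mem_map_of_mem _ (Ideal.subset_span ⟨j, rfl⟩)
  let chart : Fin 8 → (affineBlowup I₆).Opens := fun j =>
    blowupChart (affineBlowup.π I₆) (affineBlowup.idealSheaf I₆) ⟨⊤, isAffineOpen_top _⟩ (ι₀ (g8 j))
  have hchart0 : chart 0 = blowupChart (affineBlowup.π I₆) (affineBlowup.idealSheaf I₆)
      ⟨⊤, isAffineOpen_top _⟩ (ι₀ (X a ^ 2)) := rfl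
  have hchart7 : chart 7 = blowupChart (affineBlowup.π I₆) (affineBlowup.idealSheaf I₆)
      ⟨⊤, isAffineOpen_top _⟩ (ι₀ (X c ^ 6)) := rfl
  -- the charts cover `V`
  have hcovAll : ⨆ j, chart j = ⊤ := by
    have hx : Ideal.span (Set.range fun j => ι₀ (g8 j)) =
        (affineBlowup.idealSheaf I₆).ideal ⟨⊤, isAffineOpen_top _⟩ := by
      rw [hIdeal, Ideal.map_span, ← Set.range_comp]
      rfl
    have h := hπ.iSup_blowupChart (U := ⟨⊤, isAffineOpen_top _⟩) (fun j => ι₀ (g8 j)) hx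
    rw [Scheme.Hom.preimage_top] at h
    exact h
  -- `V[x_a²]` is `G`-stable (`σ x_a = x_a`)
  have hsmulXa : ∀ g : G, g • (X a : S) = X a := by
    intro g
    obtain ⟨z, hz⟩ := Subgroup.mem_zpowers_iff.mp g.2
    have hfix : (X a : S) ∈ MulAction.fixedBy S σ := ha
    have h := MulAction.fixedBy_subset_fixedBy_zpow S σ z hfix
    rw [hz] at h
    exact h
  have hsmulXa2 : ∀ g : G, g • (X a ^ 2 : S) = X a ^ 2 := fun g => by rw [smul_pow', hsmulXa g]
  have h0_st : ∀ g : G, (hπ.liftAction ρ hJ g).hom ⁻¹ᵁ chart 0 = chart 0 := fun g =>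
    ToricExit.preimage_blowupChart_eq_self_of_action hπ ρ (hπ.liftAction ρ hJ) hequiv hJ (hgj 0)
      (fun g => ToricExit.specAction_appTop_ΓSpecIso_inv ρ hρ (X a ^ 2) hsmulXa2 g) g
  -- the stable open `V[x_a²] ∪ W` and the stable affine piece `O₂ = ⋂ g·V[x_c⁶]`
  have hW_st : ∀ g : G, (hπ.liftAction ρ hJ g).hom ⁻¹ᵁ W = W := fun g => HWst ρ hρ g
  have hAW_st : ∀ g : G, (hπ.liftAction ρ hJ g).hom ⁻¹ᵁ (chart 0 ⊔ W) = chart 0 ⊔ W := fun g => by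
    rw [Scheme.Hom.preimage_sup, h0_st g, hW_st g]
  have h7_aff : IsAffineOpen (chart 7) := hπ.isAffineOpen_blowupChart (hgj 7)
  have hcov' : (chart 0 ⊔ W) ⊔ chart 7 = ⊤ := Hcov
  obtain ⟨hO₂_aff, hO₂_st, hO₂_le, hcov₂⟩ :=
    ToricExit.exists_stable_affine_cover_pair (hπ.liftAction ρ hJ) (chart 0 ⊔ W) (chart 7) hAW_st
      h7_aff hcov'
  haveI : IsAffine (chart 0 : Scheme.{0}) := hπ.isAffineOpen_blowupChart (hgj 0)
  haveI : IsAffine (W : Scheme.{0}) := HWaff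
  haveI : IsAffine ((⨅ g : G, (hπ.liftAction ρ hJ g).hom ⁻¹ᵁ chart 7 : (affineBlowup I₆).Opens) :
    Scheme.{0}) := hO₂_aff
  let O₀ : ρB.StableAffineOpens := ⟨chart 0, h0_st, isAffineHom_of_isAffine_of_isSeparated _⟩
  let O₁ : ρB.StableAffineOpens := ⟨W, hW_st, isAffineHom_of_isAffine_of_isSeparated _⟩
  let O₂ : ρB.StableAffineOpens :=
    ⟨⨅ g : G, (hπ.liftAction ρ hJ g).hom ⁻¹ᵁ chart 7, hO₂_st,
      isAffineHom_of_isAffine_of_isSeparated _⟩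
  have hcov₃ : O₀.1 ⊔ O₁.1 ⊔ O₂.1 = ⊤ := hcov₂
  -- `O₂` is non-empty: `V` is irreducible and `V[x_c⁶] ⊇ D₊(x_c⁶ t) ≠ ∅`
  have hO₂ne : ((O₂.1 : (affineBlowup I₆).Opens) : Set (affineBlowup I₆)).Nonempty := by
    haveI := hVint
    haveI := BlowupExit.nontrivial_away_reesT_of_ne_zero (I := I₆) (X c ^ 6 : S)
      (Ideal.subset_span ⟨7, rfl⟩) (pow_ne_zero 6 (X_ne_zero c))
    refine BlowupExit.nonempty_iInf_preimage_of_irreducibleSpace _ (fun g => ?_) _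
      (BlowupExit.affineBlowup_blowupChart_nonempty (I := I₆) (X c ^ 6 : S)
        (Ideal.subset_span ⟨7, rfl⟩))
    intro v
    refine ⟨(hπ.liftAction ρ hJ g).inv.base v, ?_⟩
    rw [← Scheme.Hom.comp_apply, Iso.inv_hom_id]
    rfl
  -- piece `2` is regular
  have hreg₂ : Scheme.IsRegular ((O₂.1 : (affineBlowup I₆).Opens) : Scheme.{0}) := fun y => by
    haveI : IsRegularLocalRing ((affineBlowup I₆).presheaf.stalk
        ((O₂.1 : (affineBlowup I₆).Opens).ι.base y)) := HregC y.1 (hO₂_le y.2)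
    exact IsRegularLocalRing.of_ringEquiv
      (asIso ((O₂.1 : (affineBlowup I₆).Opens).ι.stalkMap y)).commRingCatIsoToRingEquiv
  -- the vertex curves
  let Fix : Set (affineBlowup I₆) :=
    {v | (affineBlowup.π I₆).base v ∈ PrimeSpectrum.zeroLocus ({X a, X b, X c} : Set S)}
  have hFix : IsClosed Fix :=
    (PrimeSpectrum.isClosed_zeroLocus _).preimage (affineBlowup.π I₆).base.hom.continuous
  let U₀ : (affineBlowup I₆).Opens := ⨆ j : {j : Fin 8 // j ≠ 0}, chart j.1
  let U₁ : (affineBlowup I₆).Opens := ⨆ j : {j : Fin 8 // j ≠ 4}, chart j.1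
  let T₀ : Set (affineBlowup I₆) := Fix \ (U₀ : Set (affineBlowup I₆))
  let T₁ : Set (affineBlowup I₆) := Fix \ (U₁ : Set (affineBlowup I₆))
  have hT₀ : IsClosed T₀ := hFix.sdiff U₀.isOpen
  have hT₁ : IsClosed T₁ := hFix.sdiff U₁.isOpen
  -- a point outside all charts `j ≠ j₀` lies in the chart `j₀`
  have hmem_of_not : ∀ (j₀ : Fin 8) (v : affineBlowup I₆),
      v ∉ ((⨆ j : {j : Fin 8 // j ≠ j₀}, chart j.1 : (affineBlowup I₆).Opens) :
        Set (affineBlowup I₆)) → v ∈ chart j₀ := by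
    intro j₀ v hv
    have hv' : v ∈ (⨆ j, chart j : (affineBlowup I₆).Opens) := by
      rw [hcovAll]; exact Opens.mem_top v
    rw [Opens.mem_iSup] at hv'
    obtain ⟨j, hj⟩ := hv'
    by_cases hjj : j = j₀
    · exact hjj ▸ hj
    · exact absurd (Opens.mem_iSup.mpr ⟨⟨j, hjj⟩, hj⟩) hv
  have hle_of_ne : ∀ (j₀ j : Fin 8), j ≠ j₀ →
      (chart j : Set (affineBlowup I₆)) ⊆
        ((⨆ j : {j : Fin 8 // j ≠ j₀}, chart j.1 : (affineBlowup I₆).Opens) :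
          Set (affineBlowup I₆)) := by
    intro j₀ j hj v hv
    exact Opens.mem_iSup.mpr ⟨⟨j, hj⟩, hv⟩
  have h₀₀ : T₀ ⊆ ((O₀.1 : (affineBlowup I₆).Opens) : Set (affineBlowup I₆)) :=
    fun v hv => hmem_of_not 0 v hv.2
  have h₀₁ : Disjoint T₀ ((O₁.1 : (affineBlowup I₆).Opens) : Set (affineBlowup I₆)) := HC₀W
  have h₀₂ : Disjoint T₀ ((O₂.1 : (affineBlowup I₆).Opens) : Set (affineBlowup I₆)) := by
    rw [Set.disjoint_left]
    intro v hv hv₂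
    exact hv.2 (hle_of_ne 0 7 (by decide) (hO₂_le hv₂))
  have h₁₁ : T₁ ⊆ ((O₁.1 : (affineBlowup I₆).Opens) : Set (affineBlowup I₆)) := HC₁W
  have h₁₀ : Disjoint T₁ ((O₀.1 : (affineBlowup I₆).Opens) : Set (affineBlowup I₆)) := by
    rw [Set.disjoint_left]
    intro v hv hv₀
    exact hv.2 (hle_of_ne 4 0 (by decide) hv₀)
  have h₁₂ : Disjoint T₁ ((O₂.1 : (affineBlowup I₆).Opens) : Set (affineBlowup I₆)) := by
    rw [Set.disjoint_left]
    intro v hv hv₂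
    exact hv.2 (hle_of_ne 4 7 (by decide) (hO₂_le hv₂))
  -- the exit
  exact ToricExit.toricExitTransfer₃ p hp k (Spec (.of S)) (Spec (.of A)) fk q G ρ hcard hfaith hdim
    hsurj hU horb (affineBlowup I₆) (affineBlowup.π I₆) hbir ρB hequiv O₀ O₁ O₂ hcov₃ hO₂ne hreg₂
    (fun g v hv hvO => HdivC ρ hρ g v hv (hO₂_le hvO)) T₀ T₁ hT₀ hT₁ h₀₀ h₀₁ h₀₂ h₁₁ h₁₀ h₁₂
    (HP₀ ρ hρ ρB rfl O₀ rfl) (HP₁ ρ hρ ρB rfl O₁ rfl)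

end Summit.ResolutionOfSingularities.ResolutionOfSingularities.Theorems.WildQuotientResolution.JordanFour

end
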